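import Summits.QuantumFields.YangMills.Theorems.Instrument.ClosedComplexCountDFSBound
import HarnessLib

/-!
# Instrument cell `ym-instrument`, crew (b): the hypothesis-free COUNT FALLBACK for polymer classes connected through a SUB-family of links (S2-SPEC v0.3 (G4)) —
# complexes of `ℤ⁴` through an ARBITRARY fixed link, connected through «admissible» shared links, number `≤ 6·C(2n−2, n−1)·20^(n−1)` whatever the admissibility rule

QUESTIONS.md: Q-B2 ∕ J-B2a (A-0826-25, A-0826-32; S2-SPEC v0.3 `ym-instrument-sc-plan/S2-SPEC.md` 777d8c3364670be5 §1a (G1) polymer class «fine plaquette sets connected through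
shared FREE links», (G4) hypothesis-free fallback; sc-plan g2 2026-08-26T23:13:47Z ask (b); sc-ref g2 22:14:09Z ∕ 23:00:44Z); cell `run/shared/lean/pub/ym-instrument/`, HUMAN RULING
D-0084 (2), director-ym R138.  HONEST FRAMING (page 1, binding).  WHAT IS CERTIFIED HERE AND AT WHICH `(G, D, L, β)`: PURE COMBINATORICS of `ℤ⁴` (no group, no coupling, no
block map): for ANY predicate `Adm` on links («admissible» = e.g. the FREE links of the axial-2 comb gauge of S2-SPEC §1a — the instantiation is the spec's, not this file's) and
ANY side condition `P` (e.g. «every free link in ≥ 2 plaquettes»), the `n`-plaquette sets of `ℤ⁴` containing a FIXED link `e` and connected inside themselves through shared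
ADMISSIBLE links number at most ★ `6·C(2n−2, n−1)·20^(n−1) ≤ 6·80^(n−1)` — because admissible-link connectivity implies link connectivity (`isLinkConnected_of_isAdmConnected`)
and the landed DFS-contour count (`ClosedComplexCountDFSBound`: codes ∕ `exists_code_cover` ∕ `card_codes_le`, `Δ = 20`, `≤ 6` plaquettes through any link) is re-run at an
arbitrary root link (`card_linkConnected_through_le`; the landed `closedCount_four_le_choose` is the special case `e = rootLink 4`, `P = IsClosedComplex`).  WHAT THIS IS FOR: the
(G4) «kernel-disc fallback» of the S2 (α) remainder — a tiny UNCONDITIONAL Kotecký–Preiss disc for the (G1) gas by the engines of `KPCriterionSU2UnconditionalDFS` once its activity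
column is fixed; the (α) window proper stays OPEN until T2′ (census + tail for the (G1) class) exists (A-0826-32).  NOT a statement about any gauge theory, NOT a radius by
itself, NOT summit-bearing.  Grade (T).
-/

noncomputable section

open Finset
open Literature.MathematicalPhysics.QuantumLattice (ZdEdge ZdPlaquette plaquetteEdges plaquettesTouching)
open Literature.MathematicalPhysics.QuantumFieldTheory (mem_plaquettesTouching_singleton card_plaquettesTouching_singleton_le)
open Literature.MathematicalPhysics.QuantumFieldTheory.Balaban1983to89.StrongCouplingKPWindow (links IsLinkConnected)
open Summit.QuantumFields.YangMills.Theorems.Instrument.ClosedComplexCountBound (nbr card_nbr_le_twenty mem_nbr_of_adj reflTransGen_adj_of_isLinkConnected)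
open Summit.QuantumFields.YangMills.Theorems.Instrument.ClosedComplexCountDFSBound (codes decode card_codes_le mem_codes exists_code_cover)

namespace Summit.QuantumFields.YangMills.Theorems.Instrument.AdmissibleLinkComplexCount

/-! ## §1 Connectivity through admissible links implies link connectivity -/

/-- A finite plaquette set is **connected through admissible links** (`Adm`-connected) when any two of its plaquettes are joined inside it by a chain of plaquettes,
consecutive ones sharing a link `e` with `Adm e` (S2-SPEC (G1): `Adm` = «free link»; incompatibility = sharing an admissible link). [folklore] -/
def IsAdmConnected (Adm : ZdEdge 4 → Prop) (X : Finset (ZdPlaquette 4)) : Prop :=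
  ∀ p ∈ X, ∀ q ∈ X, Relation.ReflTransGen (fun a b => a ∈ X ∧ b ∈ X ∧ ∃ e, Adm e ∧ e ∈ plaquetteEdges a ∧ e ∈ plaquetteEdges b) p q

/-- `Adm`-connected ⟹ link-connected (the tree's `IsLinkConnected`): a shared admissible link is a shared link. [folklore] -/
theorem isLinkConnected_of_isAdmConnected {Adm : ZdEdge 4 → Prop} {X : Finset (ZdPlaquette 4)} (h : IsAdmConnected Adm X) : IsLinkConnected X := by
  intro p hp q hq
  have hpq := h p hp q hq
  clear hq
  induction hpq with
  | refl => exact Relation.ReflTransGen.refl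
  | @tail b c _ hbc ih =>
    obtain ⟨hb, hc, e, -, hea, heb⟩ := hbc
    exact ih.tail ⟨hb, hc, not_disjoint_iff.2 ⟨e, hea, heb⟩⟩

/-! ## §2 The DFS-contour count through an ARBITRARY fixed link -/

/-- Decoded push∕pop codes of length `2(n−1)` with `n−1` pushes from one of the (at most six) plaquettes through the link `e`. [folklore] -/
def dfsFamilyAt (e : ZdEdge 4) (n : ℕ) : Finset (Finset (ZdPlaquette 4)) :=
  (plaquettesTouching {e}).biUnion fun p => (codes nbr [p] (2 * (n - 1)) (n - 1)).image (decode p)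

/-- Every link-connected `n`-complex through `e` belongs to `dfsFamilyAt e n` (`ClosedComplexCountDFSBound.exists_code_cover` BY NAME). [folklore] -/
theorem mem_dfsFamilyAt {e : ZdEdge 4} {n : ℕ} {X : Finset (ZdPlaquette 4)} (hcard : X.card = n) (he : e ∈ links X) (hconn : IsLinkConnected X) :
    X ∈ dfsFamilyAt e n := by
  unfold links at he
  obtain ⟨p, hpX, hpe⟩ := mem_biUnion.1 he
  have hS := reflTransGen_adj_of_isLinkConnected hconn hpX
  obtain ⟨c, hlen, hpush, hval, hdec⟩ := exists_code_cover nbr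
    (R := fun x y : ZdPlaquette 4 => x ≠ y ∧ ¬ Disjoint (plaquetteEdges x) (plaquetteEdges y)) (fun _ _ h => mem_nbr_of_adj h) hpX hS
  rw [hcard] at hlen hpush
  unfold dfsFamilyAt
  exact mem_biUnion.2 ⟨p, mem_plaquettesTouching_singleton.2 hpe, mem_image.2 ⟨c, mem_codes nbr hlen hpush hval, hdec⟩⟩

/-- `#dfsFamilyAt e n ≤ 6·C(2(n−1), n−1)·20^(n−1)` for every link `e`. [folklore] -/
theorem card_dfsFamilyAt_le (e : ZdEdge 4) (n : ℕ) : (dfsFamilyAt e n).card ≤ 6 * ((2 * (n - 1)).choose (n - 1) * 20 ^ (n - 1)) := by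
  unfold dfsFamilyAt
  refine (card_biUnion_le_card_mul _ _ _ fun p _ => ?_).trans
    (Nat.mul_le_mul_right _ ((card_plaquettesTouching_singleton_le e).trans (by norm_num)))
  exact card_image_le.trans (card_codes_le nbr card_nbr_le_twenty _ _ _)

/-- ★ **Link-connected `n`-complexes through ANY fixed link, with ANY side condition, number `≤ 6·C(2n−2, n−1)·20^(n−1)`** (the landed `closedCount_four_le_choose` is
`e = rootLink 4`, `P = IsClosedComplex`). [folklore] -/
theorem card_linkConnected_through_le (e : ZdEdge 4) (n : ℕ) (P : Finset (ZdPlaquette 4) → Prop) :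
    Nat.card {X : Finset (ZdPlaquette 4) // X.card = n ∧ e ∈ links X ∧ IsLinkConnected X ∧ P X} ≤ 6 * ((2 * (n - 1)).choose (n - 1) * 20 ^ (n - 1)) := by
  have hsub : {X : Finset (ZdPlaquette 4) | X.card = n ∧ e ∈ links X ∧ IsLinkConnected X ∧ P X} ⊆ (↑(dfsFamilyAt e n) : Set (Finset (ZdPlaquette 4))) :=
    fun X hX => mem_coe.2 (mem_dfsFamilyAt hX.1 hX.2.1 hX.2.2.1)
  calc Nat.card {X : Finset (ZdPlaquette 4) // X.card = n ∧ e ∈ links X ∧ IsLinkConnected X ∧ P X}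
      = ({X : Finset (ZdPlaquette 4) | X.card = n ∧ e ∈ links X ∧ IsLinkConnected X ∧ P X}).ncard := Nat.card_coe_set_eq _
    _ ≤ (↑(dfsFamilyAt e n) : Set (Finset (ZdPlaquette 4))).ncard := Set.ncard_le_ncard hsub (finite_toSet _)
    _ = (dfsFamilyAt e n).card := Set.ncard_coe_finset _
    _ ≤ _ := card_dfsFamilyAt_le e n

/-! ## §3 ★ The (G4) fallback: admissible-link-connected classes through a fixed link -/

/-- ★ **S2-SPEC (G4) COUNT FALLBACK.**  For any admissibility rule `Adm` on links and any side condition `P`: the `n`-plaquette sets of `ℤ⁴` containing the fixed link `e`,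
`Adm`-connected inside themselves and satisfying `P`, number at most `6·C(2n−2, n−1)·20^(n−1)`.  (With `Adm` = «free link of the axial-2 comb gauge» and `P` = «every free
link in ≥ 2 plaquettes, axis links external» this is the (G1) class of S2-SPEC v0.3 pinned at a free link; the instantiation is the spec's.) [folklore] -/
theorem card_admConnected_through_le (Adm : ZdEdge 4 → Prop) (e : ZdEdge 4) (n : ℕ) (P : Finset (ZdPlaquette 4) → Prop) :
    Nat.card {X : Finset (ZdPlaquette 4) // X.card = n ∧ e ∈ links X ∧ IsAdmConnected Adm X ∧ P X} ≤ 6 * ((2 * (n - 1)).choose (n - 1) * 20 ^ (n - 1)) := by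
  have hsub : {X : Finset (ZdPlaquette 4) | X.card = n ∧ e ∈ links X ∧ IsAdmConnected Adm X ∧ P X} ⊆ (↑(dfsFamilyAt e n) : Set (Finset (ZdPlaquette 4))) :=
    fun X hX => mem_coe.2 (mem_dfsFamilyAt hX.1 hX.2.1 (isLinkConnected_of_isAdmConnected hX.2.2.1))
  calc Nat.card {X : Finset (ZdPlaquette 4) // X.card = n ∧ e ∈ links X ∧ IsAdmConnected Adm X ∧ P X}
      = ({X : Finset (ZdPlaquette 4) | X.card = n ∧ e ∈ links X ∧ IsAdmConnected Adm X ∧ P X}).ncard := Nat.card_coe_set_eq _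
    _ ≤ (↑(dfsFamilyAt e n) : Set (Finset (ZdPlaquette 4))).ncard := Set.ncard_le_ncard hsub (finite_toSet _)
    _ = (dfsFamilyAt e n).card := Set.ncard_coe_finset _
    _ ≤ _ := card_dfsFamilyAt_le e n

/-- Geometric form of the fallback: `≤ 6·80^(n−1)` (Mathlib `Nat.centralBinom_le_four_pow`). [folklore] -/
theorem card_admConnected_through_le_eighty (Adm : ZdEdge 4 → Prop) (e : ZdEdge 4) (n : ℕ) (P : Finset (ZdPlaquette 4) → Prop) :
    Nat.card {X : Finset (ZdPlaquette 4) // X.card = n ∧ e ∈ links X ∧ IsAdmConnected Adm X ∧ P X} ≤ 6 * 80 ^ (n - 1) := by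
  refine (card_admConnected_through_le Adm e n P).trans ?_
  have h : (2 * (n - 1)).choose (n - 1) ≤ 4 ^ (n - 1) := by
    rw [← Nat.centralBinom_eq_two_mul_choose]; exact Nat.centralBinom_le_four_pow _
  calc 6 * ((2 * (n - 1)).choose (n - 1) * 20 ^ (n - 1)) ≤ 6 * (4 ^ (n - 1) * 20 ^ (n - 1)) := Nat.mul_le_mul_left 6 (Nat.mul_le_mul_right _ h)
    _ = 6 * 80 ^ (n - 1) := by rw [← mul_pow]; norm_num

end Summit.QuantumFields.YangMills.Theorems.Instrument.AdmissibleLinkComplexCount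

end
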